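import Summits.AnomalousDissipation.AnomalousDissipation.Theorems.SolenoidalFractalHomogenisationLagrangianStepOneLevelGlue
import Summits.AnomalousDissipation.AnomalousDissipation.Theorems.SolenoidalFractalHomogenisationRealisedQuasiStaticCellLawSingleMode
import Summits.AnomalousDissipation.AnomalousDissipation.Theorems.SolenoidalFractalHomogenisationRealisedQuasiStaticCellLawCellUnique
import Literature.Analysis.FluidPDE.PassiveVectorTensorLionsExistence
import Literature.Analysis.FluidPDE.PassiveVectorTensorEnergyDecay
import HarnessLib

/-!
# K1L `LagrangianRenormalisationStep` (stmt-AnomalousDissipation-24912), line `onelevel`: the FREE sub-conjuncts of the cell clauses (V) and (F),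
# proved once (helper; `--supports stmt-AnomalousDissipation-24912 --as helper`)

Helper file of route `SolenoidalFractalHomogenisation` (ideator planner ad-ideate-p4 g7, findings F-p4g7-3 / F-p4g7-4; K1L SHARED-DEFS RULE: the two
reduced clauses must be LANDED decls before the tenure planner can register the skeleton whose `stub_cellLawV` / `stub_cellEnergyT` conclude them).
Same namespace `…Theorems.SolenoidalFractalHomogenisation.LagrangianStep` as `…LagrangianStepOneLevelDefs` (p613864), whose `SlowVectorClause` /
`CellEnergyClauses` are cut here:

* `SlowVectorClauseNoEx` — `SlowVectorClause` VERBATIM minus its existence conjunct `(∃ v, IsWeakTensorPassiveVectorOn 0 (2T) (effective tensor) 0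
  (Re e_ℓ • p) v) ∧`; `nearIso_effTensor` (window clause ⇒ ellipticity of `(1/n²)•(𝔸 + (c/ν)•Φ((1/ν)•𝔸))`), `exists_effective_singleMode` (J.-L. Lions'
  carrier-free theorem `Torus.exists_isWeakTensorPassiveVectorOn_zero_carrier` from the single-mode datum, K2R's `memSobolev_one_singleMode` /
  `isWeaklyDivFree_singleMode`), `slowVectorClause_of_noEx`, adapter `cellLawV_of_cellLawVNoEx` (reduced `stub_cellLawV` statement ⇒ registered one);
* `CellEnergyClausesNoE` — `CellEnergyClauses` VERBATIM minus the energy-inequality conjunct `∫ x, ‖u t x‖ ^ 2 ≤ ∫ x, ‖F x‖ ^ 2 ∧` of (F);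
  `ae_energy_le_datum` (the Literature's tensor energy inequality `Torus.IsWeakTensorPassiveVectorOn.ae_energy_ineq` [Temam1984 III §1 Lemma 1.2] with
  K2R's `memLp_top_stLift_cell`), `cellEnergyClauses_of_noE`, adapter `cellEnergyT_of_cellEnergyTNoE` (reduced `stub_cellEnergyT` statement ⇒ registered one).

No named facts, no instances, no notation, no sorry; two `def … : Prop`.  NOT a proof of the crux, of Onsager's conjecture or of anomalous dissipation.
-/

set_option linter.dupNamespace false

namespace Summit.AnomalousDissipation.AnomalousDissipation.Theorems.SolenoidalFractalHomogenisation.LagrangianStep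

open Literature.Analysis Literature.Analysis.FluidPDE Literature.Analysis.FunctionSpaces
open MeasureTheory Set Filter
open scoped ENNReal NNReal InnerProductSpace

noncomputable section

/-! ## (V) without its existence conjunct (skeleton v20 candidate block, F-p4g7-3) -/
section CellLawVNoEx

open Function
open Literature.Analysis.FluidPDE.LatticeShear (LagrangianLatticeCarrier LatticeWord)
open Summit.AnomalousDissipation.AnomalousDissipation.Theorems.SolenoidalFractalHomogenisation.RealisedQuasiStaticCellLaw
  (memLp_two_of_memSobolev_one_complexify memSobolev_one_singleMode isWeaklyDivFree_singleMode)

/-- The SLOW-VECTOR clause WITHOUT its existence conjunct (`SlowVectorClause` verbatim otherwise). -/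
def SlowVectorClauseNoEx {k : ℕ} (W : LatticeShear.LatticeWord k) (M : ℝ) (hM : 0 < M) (c : ℝ)
    (Φ : Torus.Visc4 (Fin 3) → Torus.Visc4 (Fin 3)) (lo hi Λ β σ C ν₀ K : ℝ) : Prop :=
      ∀ ν, ∀ hν : ν ∈ Set.Ioo 0 ν₀, ∀ n : ℕ, ∀ 𝔸 : Torus.Visc4 (Fin 3),
        Torus.OddSmall 𝔸 (ν * β) → (∃ lam ∈ Set.Icc (1:ℝ) Λ, Torus.NearIso 𝔸 (ν * (lo / lam)) (ν * (hi * lam))) →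
        ∀ ℓ : Fin 3 → ℤ, ℓ ≠ 0 → ‖Torus.latticeVec ℓ‖ * (⌈K / ν⌉₊ : ℝ) ≤ n →
        ∀ p : EuclideanSpace ℝ (Fin 3), ‖p‖ = 1 → ⟪p, Torus.latticeVec ℓ⟫_ℝ = 0 →
        ∀ T > (0:ℝ),
          ∀ w v : ℝ → VF,
            Torus.IsWeakTensorPassiveVectorOn 0 T ((1 / (n:ℝ) ^ 2) • 𝔸) (cellField W M hM ν hν.1 n) (fun x => (UnitAddTorus.mFourier ℓ x).re • p) w →
            Torus.IsWeakTensorPassiveVectorOn 0 (2 * T) ((1 / (n:ℝ) ^ 2) • (𝔸 + (c / ν) • Φ ((1 / ν) • 𝔸))) (fun _ _ => 0)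
                (fun x => (UnitAddTorus.mFourier ℓ x).re • p) v →
            ∀ᵐ t ∂(volume.restrict (Ioo 0 T)),
              2 * ∑ i, ‖modeCoeff ℓ (fun x => w t x - v t x) i‖ ^ 2
                  ≤ (C * (C * (ν ^ σ + (‖Torus.latticeVec ℓ‖ * (⌈K / ν⌉₊ : ℝ) / n) ^ σ) * min 1 ((8 * Real.pi ^ 2 * ‖Torus.latticeVec ℓ‖ ^ 2 * (hi * Λ) * (ν + c / ν) / (n:ℝ) ^ 2) * t) + (8 * Real.pi ^ 2 * ‖Torus.latticeVec ℓ‖ ^ 2 * (hi * Λ) * (ν + c / ν) / (n:ℝ) ^ 2) * (M * W.period / ν))) ^ 2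
                      * ∫ x, ‖(UnitAddTorus.mFourier ℓ x).re • p‖ ^ 2

/-- A non-zero lattice vector has positive norm. [folklore] -/
theorem norm_latticeVec_pos_of_ne_zero {ℓ : Fin 3 → ℤ} (hℓ : ℓ ≠ 0) : 0 < ‖Torus.latticeVec ℓ‖ := by
  refine norm_pos_iff.2 fun h => hℓ ?_
  funext i
  have hi := congrArg (fun v : EuclideanSpace ℝ (Fin 3) => v i) h
  simp only [Torus.latticeVec_apply, PiLp.zero_apply] at hi
  exact_mod_cast hi

/-- `ℓ ≠ 0` and the slow-band condition `‖ℓ‖·⌈K/ν⌉ ≤ n` (`K, ν > 0`) force `1 ≤ n`. -/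
theorem one_le_of_slowBand {ℓ : Fin 3 → ℤ} (hℓ : ℓ ≠ 0) {K ν : ℝ} (hK : 0 < K) (hν : 0 < ν) {n : ℕ}
    (h : ‖Torus.latticeVec ℓ‖ * (⌈K / ν⌉₊ : ℝ) ≤ n) : 1 ≤ (n:ℝ) := by
  have h1 : (1:ℝ) ≤ ⌈K / ν⌉₊ := by exact_mod_cast Nat.one_le_iff_ne_zero.mpr (Nat.pos_iff_ne_zero.mp (Nat.ceil_pos.mpr (div_pos hK hν)))
  have h2 : 0 < ‖Torus.latticeVec ℓ‖ := norm_latticeVec_pos_of_ne_zero hℓ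
  -- `‖latticeVec ℓ‖ ≥ 1` for a non-zero integer vector: some coordinate has `|ℓ i| ≥ 1`
  have h3 : (1:ℝ) ≤ ‖Torus.latticeVec ℓ‖ := by
    obtain ⟨i, hi⟩ : ∃ i, ℓ i ≠ 0 := by
      by_contra hc
      push Not at hc
      exact hℓ (funext hc)
    have hcoord : |(Torus.latticeVec ℓ) i| ≤ ‖Torus.latticeVec ℓ‖ := by
      have := EuclideanSpace.norm_eq (Torus.latticeVec ℓ)
      calc |(Torus.latticeVec ℓ) i| = Real.sqrt (|(Torus.latticeVec ℓ) i| ^ 2) := by rw [Real.sqrt_sq (abs_nonneg _)]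
        _ ≤ Real.sqrt (∑ j, ‖(Torus.latticeVec ℓ) j‖ ^ 2) := by
            apply Real.sqrt_le_sqrt
            rw [← Real.norm_eq_abs]
            exact Finset.single_le_sum (f := fun j => ‖(Torus.latticeVec ℓ) j‖ ^ 2) (fun j _ => sq_nonneg _) (Finset.mem_univ i)
        _ = ‖Torus.latticeVec ℓ‖ := this.symm
    have h1i : (1:ℝ) ≤ |(Torus.latticeVec ℓ) i| := by
      rw [Torus.latticeVec_apply]
      have hz : ((1:ℤ) : ℝ) ≤ ((|ℓ i| : ℤ) : ℝ) := by exact_mod_cast Int.one_le_abs hi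
      simpa [Int.cast_abs] using hz
    exact h1i.trans hcoord
  nlinarith

/-- **Ellipticity of the effective tensor from the window clause.**  For `𝔸` in the `ν`-scaled nested window and `n ≥ 1`, the effective cell
tensor `(1/n²)•(𝔸 + (c/ν)•Φ((1/ν)•𝔸))` is `NearIso` with the positive lower constant `(1/n²)·(ν + c/ν)·(lo/λ)`. -/
theorem nearIso_effTensor {Φ : FluidPDE.Torus.Visc4 (Fin 3) → FluidPDE.Torus.Visc4 (Fin 3)} {lo hi Λ β : ℝ}
    (hwin : WindowClause Φ lo hi Λ β) {ν c : ℝ} (hν : 0 < ν) (hc : 0 ≤ c) {n : ℕ}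
    {𝔸 : FluidPDE.Torus.Visc4 (Fin 3)} (hodd : FluidPDE.Torus.OddSmall 𝔸 (ν * β))
    {lam : ℝ} (hlam : lam ∈ Set.Icc (1:ℝ) Λ) (hA : FluidPDE.Torus.NearIso 𝔸 (ν * (lo / lam)) (ν * (hi * lam))) :
    FluidPDE.Torus.NearIso ((1 / (n:ℝ) ^ 2) • (𝔸 + (c / ν) • Φ ((1 / ν) • 𝔸)))
      ((1 / (n:ℝ) ^ 2) * ((ν + c / ν) * (lo / lam))) ((1 / (n:ℝ) ^ 2) * ((ν + c / ν) * (hi * lam))) := by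
  have hν0 : ν ≠ 0 := hν.ne'
  -- the rescaled tensor `(1/ν)•𝔸` is in the unscaled window
  have hodd' : FluidPDE.Torus.OddSmall ((1 / ν) • 𝔸) β := by
    have h := hodd.smul (1 / ν)
    exact oddSmall_congr h (by field_simp)
  have hA' : FluidPDE.Torus.NearIso ((1 / ν) • 𝔸) (lo / lam) (hi * lam) := by
    have h := hA.smul (c := 1 / ν) (by positivity)
    exact nearIso_congr h (by field_simp) (by field_simp)
  obtain ⟨_, hΦ⟩ := hwin lam hlam ((1 / ν) • 𝔸) hodd' hA'
  have hcν : 0 ≤ c / ν := div_nonneg hc hν.le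
  have hsum := hA.add (hΦ.smul hcν)
  have hn : (0:ℝ) ≤ 1 / (n:ℝ) ^ 2 := by positivity
  have h := hsum.smul hn
  exact nearIso_congr h (by ring) (by ring)

/-- **Existence of the effective single-mode solution** (the deleted conjunct), from the window clause and Lions' carrier-free theorem.
[cite: LionsMagenes1972, Chap. 3 Thm. 1.1] -/
theorem exists_effective_singleMode {Φ : FluidPDE.Torus.Visc4 (Fin 3) → FluidPDE.Torus.Visc4 (Fin 3)} {lo hi Λ β : ℝ}
    (hlo : 0 < lo) (hwin : WindowClause Φ lo hi Λ β) {ν c K : ℝ} (hν : 0 < ν) (hc : 0 ≤ c) (hK : 0 < K) {n : ℕ}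
    {𝔸 : FluidPDE.Torus.Visc4 (Fin 3)} (hodd : FluidPDE.Torus.OddSmall 𝔸 (ν * β))
    (hwin' : ∃ lam ∈ Set.Icc (1:ℝ) Λ, FluidPDE.Torus.NearIso 𝔸 (ν * (lo / lam)) (ν * (hi * lam)))
    {ℓ : Fin 3 → ℤ} (hℓ : ℓ ≠ 0) (hsep : ‖Torus.latticeVec ℓ‖ * (⌈K / ν⌉₊ : ℝ) ≤ n)
    {p : EuclideanSpace ℝ (Fin 3)} (hperp : ⟪p, Torus.latticeVec ℓ⟫_ℝ = 0) {T : ℝ} (hT : 0 < T) :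
    ∃ v : ℝ → VF, FluidPDE.Torus.IsWeakTensorPassiveVectorOn 0 (2 * T) ((1 / (n:ℝ) ^ 2) • (𝔸 + (c / ν) • Φ ((1 / ν) • 𝔸))) (fun _ _ => 0)
      (fun x => (UnitAddTorus.mFourier ℓ x).re • p) v := by
  obtain ⟨lam, hlam, hA⟩ := hwin'
  have hN := nearIso_effTensor (n := n) hwin hν hc hodd hlam hA
  have hn1 : 1 ≤ (n:ℝ) := one_le_of_slowBand hℓ hK hν hsep
  have hlam1 : 0 < lam := lt_of_lt_of_le one_pos hlam.1
  have hlo' : 0 < (1 / (n:ℝ) ^ 2) * ((ν + c / ν) * (lo / lam)) := by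
    have : 0 < ν + c / ν := by positivity
    positivity
  exact FluidPDE.Torus.exists_isWeakTensorPassiveVectorOn_zero_carrier (by linarith) hN hlo'
    (memLp_two_of_memSobolev_one_complexify (memSobolev_one_singleMode ℓ p)) (isWeaklyDivFree_singleMode ℓ hperp)

/-- **(V) without existence ⇒ (V).** -/
theorem slowVectorClause_of_noEx {k : ℕ} {W : LatticeWord k} {M : ℝ} {hM : 0 < M} {c : ℝ}
    {Φ : FluidPDE.Torus.Visc4 (Fin 3) → FluidPDE.Torus.Visc4 (Fin 3)} {lo hi Λ β σ C ν₀ K : ℝ}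
    (hc : 0 < c) (hlo : 0 < lo) (hK : 0 < K) (hwin : WindowClause Φ lo hi Λ β)
    (h : SlowVectorClauseNoEx W M hM c Φ lo hi Λ β σ C ν₀ K) : SlowVectorClause W M hM c Φ lo hi Λ β σ C ν₀ K := by
  intro ν hν n 𝔸 hodd hwin' ℓ hℓ hsep p hp hperp T hT
  exact ⟨exists_effective_singleMode hlo hwin hν.1 hc.le hK hodd hwin' hℓ hsep hperp hT,
    h ν hν n 𝔸 hodd hwin' ℓ hℓ hsep p hp hperp T hT⟩

/-- **ADAPTER v20 → registered.**  The proposed statement of `stub_cellLawV` (conclusion ending in `SlowVectorClauseNoEx`) implies the registered one. -/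
theorem cellLawV_of_cellLawVNoEx
    (hV : ∀ k (W : Literature.Analysis.FluidPDE.LatticeShear.LatticeWord k) (c₀ : ℝ), 0 < c₀ →
    Literature.Analysis.FluidPDE.LatticeShear.IsotropicWordGain W c₀ → ScalarLawBlock W c₀ →
    ∃ M : ℝ, ∃ hM : 0 < M, ∃ c > (0:ℝ), ∃ Φ : FluidPDE.Torus.Visc4 (Fin 3) → FluidPDE.Torus.Visc4 (Fin 3),
      ∃ lo > (0:ℝ), ∃ hi : ℝ, lo ≤ 1 ∧ 1 ≤ hi ∧ ∃ Λ > (1:ℝ), ∃ β ≥ (0:ℝ), WindowClause Φ lo hi Λ β ∧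
      ∃ σ > (0:ℝ), ∃ C : ℝ, 0 ≤ C ∧ ∃ ν₀ > (0:ℝ), ∃ K > (0:ℝ), SlowVectorClauseNoEx W M hM c Φ lo hi Λ β σ C ν₀ K) :
    ∀ k (W : Literature.Analysis.FluidPDE.LatticeShear.LatticeWord k) (c₀ : ℝ), 0 < c₀ →
    Literature.Analysis.FluidPDE.LatticeShear.IsotropicWordGain W c₀ → ScalarLawBlock W c₀ →
    ∃ M : ℝ, ∃ hM : 0 < M, ∃ c > (0:ℝ), ∃ Φ : FluidPDE.Torus.Visc4 (Fin 3) → FluidPDE.Torus.Visc4 (Fin 3),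
      ∃ lo > (0:ℝ), ∃ hi : ℝ, lo ≤ 1 ∧ 1 ≤ hi ∧ ∃ Λ > (1:ℝ), ∃ β ≥ (0:ℝ), WindowClause Φ lo hi Λ β ∧
      ∃ σ > (0:ℝ), ∃ C : ℝ, 0 ≤ C ∧ ∃ ν₀ > (0:ℝ), ∃ K > (0:ℝ), SlowVectorClause W M hM c Φ lo hi Λ β σ C ν₀ K := by
  intro k W c₀ hc₀ hG hS
  obtain ⟨M, hM, c, hc, Φ, lo, hlo, hi, hlo1, hhi1, Λ, hΛ, β, hβ, hwin, σ, hσ, C, hC, ν₀, hν₀, K, hK, hV'⟩ := hV k W c₀ hc₀ hG hS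
  exact ⟨M, hM, c, hc, Φ, lo, hlo, hi, hlo1, hhi1, Λ, hΛ, β, hβ, hwin, σ, hσ, C, hC, ν₀, hν₀, K, hK,
    slowVectorClause_of_noEx hc hlo hK hwin hV'⟩

end CellLawVNoEx

/-! ## (F) without its energy-inequality conjunct (skeleton v21 candidate block, F-p4g7-4) -/
section CellEnergyTNoE

open Function
open Literature.Analysis.FunctionSpaces.Torus (stLift)
open Literature.Analysis.FluidPDE.LatticeShear (LagrangianLatticeCarrier LatticeWord)
open Summit.AnomalousDissipation.AnomalousDissipation.Theorems.SolenoidalFractalHomogenisation.RealisedQuasiStaticCellLaw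
  (memLp_two_of_memSobolev_one_complexify memLp_top_stLift_cell)

/-- The CELL-ENERGY clauses WITHOUT the energy-inequality conjunct of (F) (`CellEnergyClauses` verbatim otherwise). -/
def CellEnergyClausesNoE {k : ℕ} (W : LatticeShear.LatticeWord k) (M : ℝ) (hM : 0 < M) (c : ℝ) (lo hi Λ β C ν₀ K : ℝ) : Prop :=
      ∀ ν, ∀ hν : ν ∈ Set.Ioo 0 ν₀, ∀ n : ℕ, ∀ 𝔸 : Torus.Visc4 (Fin 3),
        Torus.OddSmall 𝔸 (ν * β) → (∃ lam ∈ Set.Icc (1:ℝ) Λ, Torus.NearIso 𝔸 (ν * (lo / lam)) (ν * (hi * lam))) →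
        (∀ L > (0:ℝ), L * (⌈K / ν⌉₊ : ℝ) ≤ n → ∀ F : VF, IsDatum F →
            (∀ k' : Fin 3 → ℤ, ‖Torus.latticeVec k'‖ < (n:ℝ) / 2 → ∀ i, modeCoeff k' F i = 0) →
            ∀ T > (0:ℝ), ∀ u : ℝ → VF, Torus.IsWeakTensorPassiveVectorOn 0 T ((1 / (n:ℝ) ^ 2) • 𝔸) (cellField W M hM ν hν.1 n) F u →
              ∀ᵐ t ∂(volume.restrict (Ioo 0 T)),
                lowEnergy L (u t) ≤ C * (c * L ^ 2 / ((n:ℝ) ^ 2 * ν ^ 2)) * ∫ x, ‖F x‖ ^ 2) ∧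
        ∀ ℓ : Fin 3 → ℤ, ℓ ≠ 0 → ‖Torus.latticeVec ℓ‖ * (⌈K / ν⌉₊ : ℝ) ≤ n →
        ∀ p : EuclideanSpace ℝ (Fin 3), ‖p‖ = 1 → ⟪p, Torus.latticeVec ℓ⟫_ℝ = 0 →
        ∀ T > (0:ℝ), ∀ w : ℝ → VF,
            Torus.IsWeakTensorPassiveVectorOn 0 T ((1 / (n:ℝ) ^ 2) • 𝔸) (cellField W M hM ν hν.1 n) (fun x => (UnitAddTorus.mFourier ℓ x).re • p) w →
            ∀ᵐ t ∂(volume.restrict (Ioo 0 T)),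
              ∫ x, ‖w t x‖ ^ 2 - lowEnergy ((n:ℝ) / 2) (w t)
                  ≤ C * (c * ‖Torus.latticeVec ℓ‖ ^ 2 / ((n:ℝ) ^ 2 * ν ^ 2)) * ∫ x, ‖(UnitAddTorus.mFourier ℓ x).re • p‖ ^ 2

/-- **Energy inequality for every weak cell solution** (the deleted conjunct): window ellipticity + bounded continuous cell carrier + `L²`
divergence-free datum ⇒ `∫‖u t‖² ≤ ∫‖F‖²` for a.e. `t ∈ (0,T)`. [cite: Temam1984, Ch. III §1 Lemma 1.2] -/
theorem ae_energy_le_datum {k : ℕ} {W : LatticeWord k} {M : ℝ} {hM : 0 < M} {lo hi Λ : ℝ} (hlo : 0 < lo)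
    {ν : ℝ} (hν : 0 < ν) {n : ℕ} (hn : 1 ≤ (n:ℝ)) {𝔸 : FluidPDE.Torus.Visc4 (Fin 3)}
    (hwin' : ∃ lam ∈ Set.Icc (1:ℝ) Λ, FluidPDE.Torus.NearIso 𝔸 (ν * (lo / lam)) (ν * (hi * lam)))
    {F : VF} (hF : IsDatum F) {T : ℝ} {u : ℝ → VF}
    (hu : FluidPDE.Torus.IsWeakTensorPassiveVectorOn 0 T ((1 / (n:ℝ) ^ 2) • 𝔸) (cellField W M hM ν hν n) F u) :
    ∀ᵐ t ∂(volume.restrict (Ioo 0 T)), ∫ x, ‖u t x‖ ^ 2 ≤ ∫ x, ‖F x‖ ^ 2 := by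
  obtain ⟨lam, hlam, hA⟩ := hwin'
  have hlam1 : 0 < lam := lt_of_lt_of_le one_pos hlam.1
  have hN : FluidPDE.Torus.NearIso ((1 / (n:ℝ) ^ 2) • 𝔸) ((1 / (n:ℝ) ^ 2) * (ν * (lo / lam))) ((1 / (n:ℝ) ^ 2) * (ν * (hi * lam))) :=
    hA.smul (by positivity)
  have hlo' : 0 < (1 / (n:ℝ) ^ 2) * (ν * (lo / lam)) := by positivity
  have hb : MemLp (stLift (cellField W M hM ν hν n)) ∞ (volume.restrict (Ioo 0 T ×ˢ (univ : Set (EuclideanSpace ℝ (Fin 3))))) := by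
    unfold cellField
    exact memLp_top_stLift_cell _ n T
  have h := hu.ae_energy_ineq hN hlo' (memLp_two_of_memSobolev_one_complexify hF.1) hF.2.2 hb
  filter_upwards [h] with t ht
  have h1 : ENNReal.ofReal (∫ x, ‖u t x‖ ^ 2) ≤ ENNReal.ofReal (∫ x, ‖F x‖ ^ 2) := le_trans le_self_add ht
  exact (ENNReal.ofReal_le_ofReal_iff (integral_nonneg fun _ => by positivity)).1 h1

/-- `L > 0` and `L·⌈K/ν⌉ ≤ n` (`K, ν > 0`) force `1 ≤ n`. -/
theorem one_le_of_band {L K ν : ℝ} (hL : 0 < L) (hK : 0 < K) (hν : 0 < ν) {n : ℕ} (h : L * (⌈K / ν⌉₊ : ℝ) ≤ n) : 1 ≤ (n:ℝ) := by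
  have h1 : (1:ℝ) ≤ ⌈K / ν⌉₊ := by exact_mod_cast Nat.one_le_iff_ne_zero.mpr (Nat.pos_iff_ne_zero.mp (Nat.ceil_pos.mpr (div_pos hK hν)))
  have h2 : 0 < L * (⌈K / ν⌉₊ : ℝ) := by positivity
  have h3 : (0:ℝ) < n := lt_of_lt_of_le h2 h
  exact_mod_cast Nat.one_le_iff_ne_zero.mpr (by rintro rfl; simp at h3)

/-- **(C)+(F) without the energy conjunct ⇒ (C)+(F).** -/
theorem cellEnergyClauses_of_noE {k : ℕ} {W : LatticeWord k} {M : ℝ} {hM : 0 < M} {c : ℝ} {lo hi Λ β C ν₀ K : ℝ}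
    (hlo : 0 < lo) (hK : 0 < K) (h : CellEnergyClausesNoE W M hM c lo hi Λ β C ν₀ K) : CellEnergyClauses W M hM c lo hi Λ β C ν₀ K := by
  intro ν hν n 𝔸 hodd hwin'
  obtain ⟨hFcl, hCcl⟩ := h ν hν n 𝔸 hodd hwin'
  refine ⟨fun L hL hLn F hF hmodes T hT u hu => ?_, hCcl⟩
  have h1 := ae_energy_le_datum (hM := hM) hlo hν.1 (one_le_of_band hL hK hν.1 hLn) hwin' hF hu
  have h2 := hFcl L hL hLn F hF hmodes T hT u hu
  filter_upwards [h1, h2] with t ht1 ht2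
  exact ⟨ht1, ht2⟩

/-- **ADAPTER v21 → registered.**  The proposed statement of `stub_cellEnergyT` (conclusion `CellEnergyClausesNoE`) implies the registered one. -/
theorem cellEnergyT_of_cellEnergyTNoE
    (hT : ∀ k (W : Literature.Analysis.FluidPDE.LatticeShear.LatticeWord k) (M : ℝ) (hM : 0 < M) (c : ℝ), 0 < c →
    ∀ lo hi Λ β : ℝ, 0 < lo → lo ≤ 1 → 1 ≤ hi → 1 < Λ → 0 ≤ β →
      ∃ C : ℝ, 0 ≤ C ∧ ∃ ν₀ > (0:ℝ), ∃ K > (0:ℝ), CellEnergyClausesNoE W M hM c lo hi Λ β C ν₀ K) :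
    ∀ k (W : Literature.Analysis.FluidPDE.LatticeShear.LatticeWord k) (M : ℝ) (hM : 0 < M) (c : ℝ), 0 < c →
    ∀ lo hi Λ β : ℝ, 0 < lo → lo ≤ 1 → 1 ≤ hi → 1 < Λ → 0 ≤ β →
      ∃ C : ℝ, 0 ≤ C ∧ ∃ ν₀ > (0:ℝ), ∃ K > (0:ℝ), CellEnergyClauses W M hM c lo hi Λ β C ν₀ K := by
  intro k W M hM c hc lo hi Λ β hlo hlo1 hhi1 hΛ hβ
  obtain ⟨C, hC, ν₀, hν₀, K, hK, h⟩ := hT k W M hM c hc lo hi Λ β hlo hlo1 hhi1 hΛ hβ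
  exact ⟨C, hC, ν₀, hν₀, K, hK, cellEnergyClauses_of_noE hlo hK h⟩

end CellEnergyTNoE

end

end Summit.AnomalousDissipation.AnomalousDissipation.Theorems.SolenoidalFractalHomogenisation.LagrangianStep
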